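import Literature.Algebra.Homology.HyperExtAdjunction
import Mathlib.Algebra.Homology.DerivedCategory.KInjective
import Mathlib.Algebra.Homology.DerivedCategory.Linear
import Mathlib.CategoryTheory.Adjunction.Additive
import Mathlib.CategoryTheory.Preadditive.Injective.Basic
import HarnessLib

/-!
# The derived adjunction in the K-injective model:
# `Hom_{D(D)}(L M, I⟦k⟧) ≃ Hom_{D(C)}(M, (R I)⟦k⟧)` for `L ⊣ R`, `I` bounded below injective

Topic `Algebra/Homology`; namespace `Literature.Algebra.Homology`. Pure homological algebra for
Mathlib's `DerivedCategory`; everything proved, no named fact.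

Let `L : C ⥤ D ⊣ R : D ⥤ C` be an adjunction of additive functors between abelian categories.

* `homotopyHomEquivOfAdjunction adj c M J` — the induced bijection
  `Hom_{K(W)}(L M, J) ≃ₗ[𝕜] Hom_{K(V)}(M, R J)` on HOMOTOPY categories of complexes (termwise
  adjunction `mapHomologicalComplexAdj`, which respects homotopies because `L`, `R` are additive —
  Mathlib's `Functor.mapHomotopyCategory`), `[f] ↦ [adj(f)]`; `Adjunction.homLinearEquiv` — the
  hom-set bijection of an adjunction whose right adjoint is `𝕜`-linear is `𝕜`-linear.
* `IsKInjective.homLinearEquivQ` — for a K-injective cochain complex `Y`, the functor `Qh` induces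
  `Hom_{K(C)}(X, Y) ≃ₗ[𝕜] Hom_{D(C)}(Q X, Q Y)` (Mathlib `CochainComplex.IsKInjective.Qh_map_bijective`,
  Spaltenstein 1988, Prop. 1.5).
* `isKInjective_mapHomologicalComplex_of_injective` — if `L` preserves monomorphisms, `R` carries a
  bounded-below complex of injectives to a bounded-below complex of injectives
  (Mathlib `Adjunction.map_injective`), hence to a K-injective complex
  (`CochainComplex.isKInjective_of_injective`).
* **`shiftedHomLinearEquivOfAdjunction`** — for `M` ANY cochain complex in `C`, `I` a bounded-below
  complex of injectives in `D`, `L` preserving monomorphisms and `k : ℤ`: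
  `Hom_{D(D)}(Q(L M), (Q I)⟦k⟧) ≃ₗ[𝕜] Hom_{D(C)}(Q M, (Q (R I))⟦k⟧)`.
  This is the derived adjunction `LL ⊣ RR` (Lipman, *Notes on derived functors and Grothendieck
  duality*, Prop. 3.2.3; The Stacks Project, Tag 0DVC; Spaltenstein, *Resolutions of
  unbounded complexes*, Compositio Math. 65 (1988), §5–6) EVALUATED ON THE K-INJECTIVE MODEL
  `RR(Q I) = Q(R I)`: no derived functor is constructed — the statement only mentions `Q`, `L`, `R`.
* **`shiftedHomLinearEquivOfAdjunctionOfQuasiIso`** — transport along a resolution: if `ι : E ⟶ I`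
  is a quasi-isomorphism to such an `I` and `R ι` is a quasi-isomorphism too (i.e. the terms of `E`
  are `R`-acyclic in the only sense that matters), then
  `Hom_{D(D)}(Q(L M), (Q E)⟦k⟧) ≃ₗ[𝕜] Hom_{D(C)}(Q M, (Q (R E))⟦k⟧)`.

Written for Road №4 of the Hodge atlas (piece (R)/(Adj) of crux stmt-HodgeConjecture-26512: the
`Ext`-adjunction `Ext^k(g^*M•, E•) ≅ Ext^k(M•, g_*E•)` along an isogeny), where `L = g^*`, `R = g_*`.

## References
* J. Lipman, *Notes on derived functors and Grothendieck duality*, LNM 1960 (2009), Prop. 3.2.3,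
  Cor. 3.2.4. [Lipman2009]
* N. Spaltenstein, *Resolutions of unbounded complexes*, Compositio Math. 65 (1988) 121–154,
  Prop. 1.5, §6. [Spaltenstein1988]
* The Stacks Project, Tag 0DVC, Tag 09T5. [StacksProject]
* C. A. Weibel, *An introduction to homological algebra* (1994), §10.4. [Weibel1994]
-/

noncomputable section

open CategoryTheory CategoryTheory.Limits CategoryTheory.Category

namespace Literature.Algebra.Homology

universe w w' v v' u u'

/-! ### The hom-set bijection of an adjunction with a linear right adjoint is linear -/

section Linear

variable {𝕜 : Type*} [Semiring 𝕜] {V : Type u} [Category.{v} V] [Preadditive V] [Linear 𝕜 V]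
  {W : Type u'} [Category.{v'} W] [Preadditive W] [Linear 𝕜 W]
  {L : V ⥤ W} {R : W ⥤ V} (adj : L ⊣ R)

section
variable [R.Linear 𝕜]

/-- `adj.homEquiv (r • f) = r • adj.homEquiv f` when the right adjoint is `𝕜`-linear
(`adj.homEquiv f = η ≫ R f`). [cite: Weibel1994, §2.6] -/
theorem Adjunction.homEquiv_smul (X : V) (Y : W) (r : 𝕜) (f : L.obj X ⟶ Y) :
    adj.homEquiv X Y (r • f) = r • adj.homEquiv X Y f := by
  rw [CategoryTheory.Adjunction.homEquiv_unit, CategoryTheory.Adjunction.homEquiv_unit, Functor.map_smul]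
  exact Linear.comp_smul _ _ _ _ _ _

end

variable [R.Additive]

/-- `adj.homEquiv (f + g) = adj.homEquiv f + adj.homEquiv g` when the right adjoint is additive.
[cite: Weibel1994, §2.6] -/
theorem Adjunction.homEquiv_add' (X : V) (Y : W) (f g : L.obj X ⟶ Y) :
    adj.homEquiv X Y (f + g) = adj.homEquiv X Y f + adj.homEquiv X Y g := by
  rw [CategoryTheory.Adjunction.homEquiv_unit, CategoryTheory.Adjunction.homEquiv_unit,
    CategoryTheory.Adjunction.homEquiv_unit, Functor.map_add]
  exact Preadditive.comp_add _ _ _ _ _ _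

variable [R.Linear 𝕜]

/-- **The hom-set bijection `Hom(L X, Y) ≃ₗ[𝕜] Hom(X, R Y)` of an adjunction whose right adjoint is
additive and `𝕜`-linear is `𝕜`-linear.** [folklore] -/
def Adjunction.homLinearEquiv (X : V) (Y : W) : (L.obj X ⟶ Y) ≃ₗ[𝕜] (X ⟶ R.obj Y) :=
  { adj.homEquiv X Y with
    map_add' := fun f g => Adjunction.homEquiv_add' adj X Y f g
    map_smul' := fun r f => Adjunction.homEquiv_smul adj X Y r f }

/-- `Adjunction.homLinearEquiv` is `adj.homEquiv`. [cite: Weibel1994, §2.6] -/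
@[simp] theorem Adjunction.homLinearEquiv_apply (X : V) (Y : W) (f : L.obj X ⟶ Y) :
    Adjunction.homLinearEquiv (𝕜 := 𝕜) adj X Y f = adj.homEquiv X Y f := rfl

end Linear

/-! ### An adjunction of additive functors descends to the homotopy categories -/

section Homotopy

variable {𝕜 : Type*} [Semiring 𝕜] {ι : Type*} {V : Type u} [Category.{v} V] [Preadditive V]
  [Linear 𝕜 V] {W : Type u'} [Category.{v'} W] [Preadditive W] [Linear 𝕜 W]
  {L : V ⥤ W} {R : W ⥤ V} (adj : L ⊣ R) [L.Additive] [R.Additive] [R.Linear 𝕜]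
  (c : ComplexShape ι)

/-- `Hom_{K(W)}(L M, J) → Hom_{K(V)}(M, R J)`, `φ ↦ [η_M] ≫ R φ` (Mathlib `Functor.mapHomotopyCategory`).
[folklore] -/
def homotopyHomOfAdjunction (M : HomologicalComplex V c) (J : HomologicalComplex W c)
    (φ : (HomotopyCategory.quotient W c).obj ((L.mapHomologicalComplex c).obj M) ⟶
      (HomotopyCategory.quotient W c).obj J) :
    (HomotopyCategory.quotient V c).obj M ⟶
      (HomotopyCategory.quotient V c).obj ((R.mapHomologicalComplex c).obj J) :=
  (HomotopyCategory.quotient V c).map ((mapHomologicalComplexAdj adj c).unit.app M) ≫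
    (R.mapHomotopyCategory c).map φ

/-- `Hom_{K(V)}(M, R J) → Hom_{K(W)}(L M, J)`, `ψ ↦ L ψ ≫ [ε_J]`. [folklore] -/
def homotopyInvOfAdjunction (M : HomologicalComplex V c) (J : HomologicalComplex W c)
    (ψ : (HomotopyCategory.quotient V c).obj M ⟶
      (HomotopyCategory.quotient V c).obj ((R.mapHomologicalComplex c).obj J)) :
    (HomotopyCategory.quotient W c).obj ((L.mapHomologicalComplex c).obj M) ⟶
      (HomotopyCategory.quotient W c).obj J :=
  (L.mapHomotopyCategory c).map ψ ≫
    (HomotopyCategory.quotient W c).map ((mapHomologicalComplexAdj adj c).counit.app J)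

/-- On a representative: `[η] ≫ R[f] = [adj(f)]`. [cite: Weibel1994, §10.4] -/
theorem homotopyHomOfAdjunction_quotient_map (M : HomologicalComplex V c) (J : HomologicalComplex W c)
    (f : (L.mapHomologicalComplex c).obj M ⟶ J) :
    homotopyHomOfAdjunction adj c M J ((HomotopyCategory.quotient W c).map f) =
      (HomotopyCategory.quotient V c).map ((mapHomologicalComplexAdj adj c).homEquiv M J f) := by
  simp only [homotopyHomOfAdjunction, CategoryTheory.Adjunction.homEquiv_unit]
  exact ((HomotopyCategory.quotient V c).map_comp _ _).symm

/-- On a representative: `L[g] ≫ [ε] = [adj⁻¹(g)]`. [cite: Weibel1994, §10.4] -/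
theorem homotopyInvOfAdjunction_quotient_map (M : HomologicalComplex V c) (J : HomologicalComplex W c)
    (g : M ⟶ (R.mapHomologicalComplex c).obj J) :
    homotopyInvOfAdjunction adj c M J ((HomotopyCategory.quotient V c).map g) =
      (HomotopyCategory.quotient W c).map (((mapHomologicalComplexAdj adj c).homEquiv M J).symm g) := by
  simp only [homotopyInvOfAdjunction, CategoryTheory.Adjunction.homEquiv_counit]
  exact ((HomotopyCategory.quotient W c).map_comp _ _).symm

/-- **An adjunction `L ⊣ R` of additive functors induces the bijection
`Hom_{K(W)}(L M, J) ≃ₗ[𝕜] Hom_{K(V)}(M, R J)` on homotopy categories of complexes**, `𝕜`-linear when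
`R` is: `[f] ↦ [adj(f)]` on representatives (homotopies are respected because `L`, `R` are additive —
Mathlib `Functor.mapHomotopyCategory`). (Weibel §10.4 / folklore: adjoint additive functors stay
adjoint on `K(–)`.) [cite: Weibel1994, §2.6 and §10.4] -/
def homotopyHomEquivOfAdjunction (M : HomologicalComplex V c) (J : HomologicalComplex W c) :
    ((HomotopyCategory.quotient W c).obj ((L.mapHomologicalComplex c).obj M) ⟶
        (HomotopyCategory.quotient W c).obj J) ≃ₗ[𝕜]
      ((HomotopyCategory.quotient V c).obj M ⟶
        (HomotopyCategory.quotient V c).obj ((R.mapHomologicalComplex c).obj J)) where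
  toFun := homotopyHomOfAdjunction adj c M J
  invFun := homotopyInvOfAdjunction adj c M J
  left_inv φ := by
    obtain ⟨f, rfl⟩ := (HomotopyCategory.quotient W c).map_surjective φ
    rw [homotopyHomOfAdjunction_quotient_map, homotopyInvOfAdjunction_quotient_map,
      Equiv.symm_apply_apply]
  right_inv ψ := by
    obtain ⟨g, rfl⟩ := (HomotopyCategory.quotient V c).map_surjective ψ
    rw [homotopyInvOfAdjunction_quotient_map, homotopyHomOfAdjunction_quotient_map,
      Equiv.apply_symm_apply]
  map_add' φ φ' := by
    change _ ≫ (R.mapHomotopyCategory c).map (φ + φ') = _ ≫ _ + _ ≫ _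
    rw [(R.mapHomotopyCategory c).map_add]
    exact Preadditive.comp_add _ _ _ _ _ _
  map_smul' r φ := by
    change _ ≫ (R.mapHomotopyCategory c).map (r • φ) = r • (_ ≫ _)
    rw [(R.mapHomotopyCategory c).map_smul]
    exact Linear.comp_smul _ _ _ _ _ _

/-- `homotopyHomEquivOfAdjunction` on a representative: `[f] ↦ [adj(f)]` (termwise transposes,
`mapHomologicalComplexAdj_homEquiv_apply_f`). [cite: Weibel1994, §10.4] -/
theorem homotopyHomEquivOfAdjunction_quotient_map (M : HomologicalComplex V c)
    (J : HomologicalComplex W c) (f : (L.mapHomologicalComplex c).obj M ⟶ J) :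
    homotopyHomEquivOfAdjunction (𝕜 := 𝕜) adj c M J ((HomotopyCategory.quotient W c).map f) =
      (HomotopyCategory.quotient V c).map ((mapHomologicalComplexAdj adj c).homEquiv M J f) :=
  homotopyHomOfAdjunction_quotient_map adj c M J f

end Homotopy

/-! ### Morphisms to a K-injective complex: homotopy classes = morphisms in the derived category -/

section KInjective

variable {𝕜 : Type*} [Ring 𝕜] {C : Type u} [Category.{v} C] [Abelian C] [Linear 𝕜 C]
  [HasDerivedCategory.{w} C]

/-- **For a K-injective cochain complex `Y`, `Hom_{K(C)}(X, Y) ≃ₗ[𝕜] Hom_{D(C)}(Q X, Q Y)`** — the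
localization functor `Qh : K(C) → D(C)` is bijective on morphisms INTO a K-injective complex
(Spaltenstein 1988, Prop. 1.5; Mathlib `CochainComplex.IsKInjective.Qh_map_bijective`), composed
with `quotient ⋙ Qh ≅ Q`. [cite: Spaltenstein1988, Prop. 1.5] -/
def IsKInjective.homLinearEquivQ (X Y : CochainComplex C ℤ) [Y.IsKInjective] :
    ((HomotopyCategory.quotient C (ComplexShape.up ℤ)).obj X ⟶
        (HomotopyCategory.quotient C (ComplexShape.up ℤ)).obj Y) ≃ₗ[𝕜]
      (DerivedCategory.Q.obj X ⟶ DerivedCategory.Q.obj Y) :=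
  (LinearEquiv.ofBijective (DerivedCategory.Qh.mapLinearMap 𝕜)
      (CochainComplex.IsKInjective.Qh_map_bijective _ Y)).trans
    (Linear.homCongr 𝕜 ((DerivedCategory.quotientCompQhIso C).app X)
      ((DerivedCategory.quotientCompQhIso C).app Y))

/-- `IsKInjective.homLinearEquivQ` on a representative: `[f] ↦ Q f`. [cite: Spaltenstein1988, Prop. 1.5] -/
theorem IsKInjective.homLinearEquivQ_quotient_map (X Y : CochainComplex C ℤ) [Y.IsKInjective]
    (f : X ⟶ Y) :
    IsKInjective.homLinearEquivQ (𝕜 := 𝕜) X Y ((HomotopyCategory.quotient C _).map f) =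
      DerivedCategory.Q.map f := by
  simp only [IsKInjective.homLinearEquivQ, LinearEquiv.trans_apply, LinearEquiv.ofBijective_apply,
    Functor.mapLinearMap_apply, Linear.homCongr_apply, Iso.app_inv, Iso.app_hom, assoc]
  calc _ = (DerivedCategory.quotientCompQhIso C).inv.app X ≫
      ((HomotopyCategory.quotient C (ComplexShape.up ℤ) ⋙ DerivedCategory.Qh).map f ≫
        (DerivedCategory.quotientCompQhIso C).hom.app Y) := rfl
    _ = (DerivedCategory.quotientCompQhIso C).inv.app X ≫
      ((DerivedCategory.quotientCompQhIso C).hom.app X ≫ DerivedCategory.Q.map f) := by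
        rw [(DerivedCategory.quotientCompQhIso C).hom.naturality]
    _ = DerivedCategory.Q.map f := by rw [Iso.inv_hom_id_app_assoc]

end KInjective

/-! ### `R` of a bounded-below complex of injectives is K-injective -/

section Injectives

variable {C : Type u} [Category.{v} C] [Abelian C] {D : Type u'} [Category.{v'} D] [Abelian D]
  {L : C ⥤ D} {R : D ⥤ C}

/-- `R` preserves injective objects when its left adjoint preserves monomorphisms
(Mathlib `Adjunction.map_injective`; Weibel Prop. 2.3.10), termwise on a complex.
[cite: Weibel1994, Prop. 2.3.10] -/
theorem injective_mapHomologicalComplex_X (adj : L ⊣ R) [R.Additive] [L.PreservesMonomorphisms]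
    (I : CochainComplex D ℤ) [hI : ∀ n, Injective (I.X n)] (n : ℤ) :
    Injective (((R.mapHomologicalComplex (ComplexShape.up ℤ)).obj I).X n) :=
  adj.map_injective _ (hI n)

/-- `R` of a complex concentrated in degrees `≥ a` is concentrated in degrees `≥ a` (plumbing).
[folklore] -/
private theorem isStrictlyGE_mapHomologicalComplex (R : D ⥤ C) [R.Additive] (I : CochainComplex D ℤ) (a : ℤ)
    [I.IsStrictlyGE a] :
    CochainComplex.IsStrictlyGE ((R.mapHomologicalComplex (ComplexShape.up ℤ)).obj I) a := by
  rw [CochainComplex.isStrictlyGE_iff]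
  intro i hi
  exact Functor.map_isZero R (I.isZero_of_isStrictlyGE a i hi)

/-- **`R I` is K-injective for `I` a bounded-below complex of injectives and `L ⊣ R` with `L`
preserving monomorphisms** (`R` preserves injectives; bounded-below complexes of injectives are
K-injective, Mathlib `CochainComplex.isKInjective_of_injective`, Spaltenstein 1988 / Hartshorne RD
I.4.6). [cite: Spaltenstein1988, §1] -/
theorem isKInjective_mapHomologicalComplex_of_injective (adj : L ⊣ R) [R.Additive]
    [L.PreservesMonomorphisms] (I : CochainComplex D ℤ) (a : ℤ) [I.IsStrictlyGE a]
    [∀ n, Injective (I.X n)] :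
    CochainComplex.IsKInjective ((R.mapHomologicalComplex (ComplexShape.up ℤ)).obj I) :=
  haveI := isStrictlyGE_mapHomologicalComplex R I a
  haveI := injective_mapHomologicalComplex_X adj I
  CochainComplex.isKInjective_of_injective _ a

end Injectives

/-! ### The derived adjunction on the K-injective model -/

section Main

variable {𝕜 : Type*} [Ring 𝕜] {C : Type u} [Category.{v} C] [Abelian C] [Linear 𝕜 C]
  {D : Type u'} [Category.{v'} D] [Abelian D] [Linear 𝕜 D]
  [HasDerivedCategory.{w} C] [HasDerivedCategory.{w'} D]
  {L : C ⥤ D} {R : D ⥤ C}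

/-- `Hom_{D}(Q X, (Q Y)⟦k⟧) ≃ₗ[𝕜] Hom_{D}(Q X, Q (Y⟦k⟧))` (`Q` commutes with the shifts). [folklore] -/
def shiftedHomQLinearEquiv {E : Type u} [Category.{v} E] [Abelian E] [Linear 𝕜 E]
    [HasDerivedCategory.{w} E] (X Y : CochainComplex E ℤ) (k : ℤ) :
    ShiftedHom (DerivedCategory.Q.obj X) (DerivedCategory.Q.obj Y) k ≃ₗ[𝕜]
      (DerivedCategory.Q.obj X ⟶ DerivedCategory.Q.obj (Y⟦k⟧)) :=
  Linear.homCongr 𝕜 (Iso.refl _) ((DerivedCategory.Q.commShiftIso k).app Y).symm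

/-- **The derived adjunction `Hom_{D(D)}(Q(L M), (Q I)⟦k⟧) ≃ₗ[𝕜] Hom_{D(C)}(Q M, (Q (R I))⟦k⟧)` on the
K-injective model**, for `L ⊣ R` additive between abelian categories with `L` preserving
monomorphisms and `R` `𝕜`-linear, `M` ANY cochain complex and `I` a bounded-below complex of
injectives: both sides are homotopy classes of maps (`I⟦k⟧` and `(R I)⟦k⟧ = R(I⟦k⟧)` are K-injective),
identified by the termwise adjunction. This is `Hom(LL M, I⟦k⟧) = Hom(M, RR I⟦k⟧)` (Lipman Prop. 3.2.3,
Stacks Tag 0DVC, Spaltenstein §6) with `Q(L M)` on the left (`L` need not be exact: no derived functor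
of `L` is asserted) and `RR(Q I) = Q(R I)`.
[cite: Lipman2009, Prop. 3.2.3] [cite: Spaltenstein1988, Prop. 1.5 and §6] [cite: StacksProject, Tag 0DVC] -/
def shiftedHomLinearEquivOfAdjunction (adj : L ⊣ R) [L.Additive] [R.Additive] [R.Linear 𝕜]
    [L.PreservesMonomorphisms] (M : CochainComplex C ℤ) (I : CochainComplex D ℤ) (a : ℤ)
    [I.IsStrictlyGE a] [∀ n, Injective (I.X n)] (k : ℤ) :
    ShiftedHom (DerivedCategory.Q.obj ((L.mapHomologicalComplex (ComplexShape.up ℤ)).obj M))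
        (DerivedCategory.Q.obj I) k ≃ₗ[𝕜]
      ShiftedHom (DerivedCategory.Q.obj M)
        (DerivedCategory.Q.obj ((R.mapHomologicalComplex (ComplexShape.up ℤ)).obj I)) k :=
  haveI : I.IsKInjective := CochainComplex.isKInjective_of_injective I a
  haveI : CochainComplex.IsKInjective ((R.mapHomologicalComplex (ComplexShape.up ℤ)).obj I) :=
    isKInjective_mapHomologicalComplex_of_injective adj I a
  haveI : CochainComplex.IsKInjective (((R.mapHomologicalComplex (ComplexShape.up ℤ)).obj I)⟦k⟧) :=
    inferInstance
  haveI : CochainComplex.IsKInjective ((R.mapHomologicalComplex (ComplexShape.up ℤ)).obj (I⟦k⟧)) :=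
    CochainComplex.isKInjective_of_iso
      (show ((R.mapHomologicalComplex (ComplexShape.up ℤ)).obj I)⟦k⟧ ≅
          (R.mapHomologicalComplex (ComplexShape.up ℤ)).obj (I⟦k⟧) from
        (((R.mapHomologicalComplex (ComplexShape.up ℤ)).commShiftIso k).app I).symm)
  (shiftedHomQLinearEquiv _ I k).trans <|
    ((IsKInjective.homLinearEquivQ _ (I⟦k⟧)).symm.trans <|
      (homotopyHomEquivOfAdjunction adj (ComplexShape.up ℤ) M (I⟦k⟧)).trans <|
        (IsKInjective.homLinearEquivQ M ((R.mapHomologicalComplex (ComplexShape.up ℤ)).obj (I⟦k⟧))).trans <|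
          (Linear.homCongr 𝕜 (Iso.refl _) (DerivedCategory.Q.mapIso
              (((R.mapHomologicalComplex (ComplexShape.up ℤ)).commShiftIso k).app I))).trans
            (shiftedHomQLinearEquiv M _ k).symm)

/-- **Transport along a resolution.** If `ι : E ⟶ I` is a quasi-isomorphism into a bounded-below
complex of injectives and `R ι` is a quasi-isomorphism as well, then
`Hom_{D(D)}(Q(L M), (Q E)⟦k⟧) ≃ₗ[𝕜] Hom_{D(C)}(Q M, (Q (R E))⟦k⟧)` for every cochain complex `M`
(the hypothesis on `R ι` says `Q(R E) ≅ RR(Q E)`: the terms of `E` are `R`-acyclic).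
[cite: Lipman2009, Prop. 3.2.3 and Cor. 3.2.4] [cite: StacksProject, Tag 0DVC] -/
def shiftedHomLinearEquivOfAdjunctionOfQuasiIso (adj : L ⊣ R) [L.Additive] [R.Additive]
    [R.Linear 𝕜] [L.PreservesMonomorphisms] (M : CochainComplex C ℤ) {E I : CochainComplex D ℤ}
    (ι : E ⟶ I) [QuasiIso ι] (a : ℤ) [I.IsStrictlyGE a] [∀ n, Injective (I.X n)]
    (hR : QuasiIso ((R.mapHomologicalComplex (ComplexShape.up ℤ)).map ι)) (k : ℤ) :
    ShiftedHom (DerivedCategory.Q.obj ((L.mapHomologicalComplex (ComplexShape.up ℤ)).obj M))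
        (DerivedCategory.Q.obj E) k ≃ₗ[𝕜]
      ShiftedHom (DerivedCategory.Q.obj M)
        (DerivedCategory.Q.obj ((R.mapHomologicalComplex (ComplexShape.up ℤ)).obj E)) k :=
  haveI : IsIso (DerivedCategory.Q.map ι) := by
    rw [DerivedCategory.isIso_Q_map_iff_quasiIso]; infer_instance
  haveI : IsIso (DerivedCategory.Q.map ((R.mapHomologicalComplex (ComplexShape.up ℤ)).map ι)) := by
    rw [DerivedCategory.isIso_Q_map_iff_quasiIso]; exact hR
  (Linear.homCongr 𝕜 (Iso.refl _)
      ((shiftFunctor (DerivedCategory D) k).mapIso (asIso (DerivedCategory.Q.map ι)))).trans <|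
    (shiftedHomLinearEquivOfAdjunction adj M I a k).trans
      (Linear.homCongr 𝕜 (Iso.refl _) ((shiftFunctor (DerivedCategory C) k).mapIso
        (asIso (DerivedCategory.Q.map ((R.mapHomologicalComplex (ComplexShape.up ℤ)).map ι))))).symm

end Main

end Literature.Algebra.Homology

end
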